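import Mathlib.Analysis.Fourier.FiniteAbelian.PontryaginDuality
import Mathlib.Analysis.RCLike.Basic
import Mathlib.LinearAlgebra.Matrix.PosDef

/-!
# Crux `PricedLinkCensus.TruncatedCensusGap` (stmt-AtomisticToContinuum-14230), line `near-far-split`,
# stub N2 `stub_harmonicCoercivityWindow`: positivity of block-convolution forms from their symbols

The certified core of N2 (whichever route: Bloch analysis of each periodic word, or the local
transfer certificate summed over layers) ends in the same elementary step: a translation-invariant
quadratic form with MATRIX-valued finite-range kernel `K : G → Matrix ι ι ℂ` on vector fields
`u : G → ι → ℂ` over a finite abelian group `G` (a large discrete torus `(ℤ/L)² ` or `(ℤ/L)³`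
containing the support of the displacement field without wrap-around),
`Q(u) = Σ_x Σ_y u(x)ᴴ K(x - y) u(y)`,
is nonnegative as soon as its SYMBOL `K̂(ψ) = Σ_d ψ(d) K(d)` is positive semidefinite at every
additive character `ψ` of `G` (discrete Bochner / Plancherel).  This file proves exactly that,
`def`-free:

* `sum_addChar_threeSums_eq` — the scalar Plancherel identity
  `Σ_ψ (Σ_x ψ(-x) a x)(Σ_d ψ d k d)(Σ_y ψ y b y) = |G| Σ_x Σ_y a x · k (x - y) · b y`;
* `sum_addChar_symbolForm_eq` — its block form
  `Σ_ψ ûψᴴ K̂(ψ) ûψ = |G| · Q(u)` with `ûψ = Σ_x ψ x • u x`;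
* `re_blockConvForm_nonneg_of_symbol` — **if `Re vᴴ K̂(ψ) v ≥ 0` for all `ψ`, `v`, then
  `Re Q(u) ≥ 0`** for every `u` (`…_of_symbol_posSemidef`: `Matrix.PosSemidef` symbols;
  `blockConvForm_nonneg_of_symbol_real`: real kernels and real fields).

All `[folklore]` (Fourier analysis on finite abelian groups; Mathlib's `AddChar.sum_apply_eq_ite`).
-/

noncomputable section

namespace Summit.AtomisticToContinuum.Crystallization.Theorems.PricedLinkCensusTruncatedCensusGap

open scoped BigOperators ComplexConjugate ComplexOrder
open Finset

variable {G : Type*} [AddCommGroup G] [Fintype G] [DecidableEq G]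
variable {ι : Type*} [Fintype ι]

/-- **Scalar Plancherel identity on a finite abelian group**: for `a k b : G → ℂ`,
`Σ_ψ (Σ_x ψ(-x) a x) · ((Σ_d ψ d · k d) · (Σ_y ψ y · b y)) = |G| · Σ_x Σ_y a x · (k (x - y) · b y)`
(orthogonality `Σ_ψ ψ g = |G| [g = 0]`). [folklore] -/
theorem sum_addChar_threeSums_eq (a k b : G → ℂ) :
    ∑ ψ : AddChar G ℂ, (∑ x, ψ (-x) * a x) * ((∑ d, ψ d * k d) * (∑ y, ψ y * b y)) =
      (Fintype.card G : ℂ) * ∑ x, ∑ y, a x * (k (x - y) * b y) := by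
  -- expand the three products into a triple sum and combine the characters
  have expand : ∀ ψ : AddChar G ℂ,
      (∑ x, ψ (-x) * a x) * ((∑ d, ψ d * k d) * (∑ y, ψ y * b y)) =
        ∑ x, ∑ y, ∑ d, ψ (-x + d + y) * (a x * (k d * b y)) := by
    intro ψ
    rw [Finset.sum_mul]
    refine Finset.sum_congr rfl fun x _ => ?_
    rw [Finset.sum_mul_sum, Finset.mul_sum, Finset.sum_comm]
    refine Finset.sum_congr rfl fun y _ => ?_
    rw [Finset.mul_sum]
    refine Finset.sum_congr rfl fun d _ => ?_
    rw [AddChar.map_add_eq_mul, AddChar.map_add_eq_mul]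
    ring
  simp_rw [expand]
  -- swap the character sum inside and use orthogonality
  rw [Finset.sum_comm]
  rw [Finset.mul_sum]
  refine Finset.sum_congr rfl fun x _ => ?_
  rw [Finset.sum_comm, Finset.mul_sum]
  refine Finset.sum_congr rfl fun y _ => ?_
  rw [Finset.sum_comm]
  simp_rw [← Finset.sum_mul, AddChar.sum_apply_eq_ite]
  simp_rw [ite_mul, zero_mul]
  rw [Finset.sum_ite, Finset.sum_const_zero, add_zero]
  have hfilter : (Finset.univ.filter fun d : G => -x + d + y = 0) = {x - y} := by
    ext d
    simp only [Finset.mem_filter, Finset.mem_univ, true_and, Finset.mem_singleton]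
    constructor
    · intro h
      have : d = -(-x) - y := by
        have h' : d = 0 - (-x) - y := by rw [← h]; abel
        rw [h']; abel
      rw [this]; abel
    · rintro rfl; abel
  rw [hfilter, Finset.sum_singleton]

/-- **Block Plancherel identity**: with `ûψ = Σ_x ψ x • u x` and `K̂ψ = Σ_d ψ d • K d`,
`Σ_ψ ûψᴴ (K̂ψ ûψ) = |G| · Σ_x Σ_y u(x)ᴴ K(x - y) u(y)`. [folklore] -/
theorem sum_addChar_symbolForm_eq (K : G → Matrix ι ι ℂ) (u : G → ι → ℂ) :
    ∑ ψ : AddChar G ℂ, star (∑ x, ψ x • u x) ⬝ᵥ ((∑ d, ψ d • K d).mulVec (∑ y, ψ y • u y)) =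
      (Fintype.card G : ℂ) * ∑ x, ∑ y, star (u x) ⬝ᵥ ((K (x - y)).mulVec (u y)) := by
  -- write both sides in coordinates
  have lhs : ∀ ψ : AddChar G ℂ,
      star (∑ x, ψ x • u x) ⬝ᵥ ((∑ d, ψ d • K d).mulVec (∑ y, ψ y • u y)) =
        ∑ i, ∑ j, (∑ x, ψ (-x) * conj (u x i)) * ((∑ d, ψ d * K d i j) * (∑ y, ψ y * u y j)) := by
    intro ψ
    simp only [dotProduct, Matrix.mulVec, Pi.star_apply, Finset.sum_apply, Pi.smul_apply,
      Matrix.sum_apply, Matrix.smul_apply, smul_eq_mul, star_sum, star_mul', Complex.star_def,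
      AddChar.map_neg_eq_conj, Finset.mul_sum]
  have rhs : ∀ x y : G, star (u x) ⬝ᵥ ((K (x - y)).mulVec (u y)) =
      ∑ i, ∑ j, conj (u x i) * (K (x - y) i j * u y j) := by
    intro x y
    simp only [dotProduct, Matrix.mulVec, Pi.star_apply, Complex.star_def, Finset.mul_sum]
  simp_rw [lhs, rhs]
  calc ∑ ψ : AddChar G ℂ, ∑ i, ∑ j, (∑ x, ψ (-x) * conj (u x i)) *
          ((∑ d, ψ d * K d i j) * (∑ y, ψ y * u y j))
      = ∑ i, ∑ j, ∑ ψ : AddChar G ℂ, (∑ x, ψ (-x) * conj (u x i)) *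
          ((∑ d, ψ d * K d i j) * (∑ y, ψ y * u y j)) := by
        rw [Finset.sum_comm]
        exact Finset.sum_congr rfl fun i _ => Finset.sum_comm
    _ = ∑ i, ∑ j, (Fintype.card G : ℂ) * ∑ x, ∑ y, conj (u x i) * (K (x - y) i j * u y j) := by
        refine Finset.sum_congr rfl fun i _ => Finset.sum_congr rfl fun j _ => ?_
        exact sum_addChar_threeSums_eq (fun x => conj (u x i)) (fun d => K d i j) (fun y => u y j)
    _ = (Fintype.card G : ℂ) * ∑ i, ∑ j, ∑ x, ∑ y, conj (u x i) * (K (x - y) i j * u y j) := by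
        rw [Finset.mul_sum]
        exact Finset.sum_congr rfl fun i _ => (Finset.mul_sum _ _ _).symm
    _ = (Fintype.card G : ℂ) * ∑ x, ∑ y, ∑ i, ∑ j, conj (u x i) * (K (x - y) i j * u y j) := by
        congr 1
        -- reorder (i, j, x, y) ↦ (x, y, i, j)
        calc ∑ i, ∑ j, ∑ x, ∑ y, conj (u x i) * (K (x - y) i j * u y j)
            = ∑ i, ∑ x, ∑ y, ∑ j, conj (u x i) * (K (x - y) i j * u y j) := by
              refine Finset.sum_congr rfl fun i _ => ?_
              rw [Finset.sum_comm]
              exact Finset.sum_congr rfl fun x _ => Finset.sum_comm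
          _ = ∑ x, ∑ i, ∑ y, ∑ j, conj (u x i) * (K (x - y) i j * u y j) := Finset.sum_comm
          _ = ∑ x, ∑ y, ∑ i, ∑ j, conj (u x i) * (K (x - y) i j * u y j) :=
              Finset.sum_congr rfl fun x _ => Finset.sum_comm

/-- **Positivity of a block-convolution form from its symbol** (discrete Bochner on a finite
abelian group, matrix-valued): if `Re (vᴴ K̂(ψ) v) ≥ 0` for every character `ψ` and every
`v : ι → ℂ`, then `Re Σ_x Σ_y u(x)ᴴ K(x - y) u(y) ≥ 0` for every field `u : G → ι → ℂ`.
[folklore] -/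
theorem re_blockConvForm_nonneg_of_symbol (K : G → Matrix ι ι ℂ)
    (hK : ∀ (ψ : AddChar G ℂ) (v : ι → ℂ), 0 ≤ (star v ⬝ᵥ ((∑ d, ψ d • K d).mulVec v)).re)
    (u : G → ι → ℂ) :
    0 ≤ (∑ x, ∑ y, star (u x) ⬝ᵥ ((K (x - y)).mulVec (u y))).re := by
  have h := congrArg Complex.re (sum_addChar_symbolForm_eq K u)
  rw [Complex.re_sum] at h
  have hsum : 0 ≤ ∑ ψ : AddChar G ℂ,
      (star (∑ x, ψ x • u x) ⬝ᵥ ((∑ d, ψ d • K d).mulVec (∑ y, ψ y • u y))).re :=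
    Finset.sum_nonneg fun ψ _ => hK ψ _
  rw [h, Complex.mul_re, Complex.natCast_re, Complex.natCast_im, zero_mul, sub_zero] at hsum
  have hc : (0 : ℝ) < Fintype.card G := Nat.cast_pos.mpr Fintype.card_pos
  exact (mul_nonneg_iff_of_pos_left hc).mp hsum

/-- The same positivity for a kernel that is positive semidefinite at every character
(`Matrix.PosSemidef` of the symbol). [folklore] -/
theorem re_blockConvForm_nonneg_of_symbol_posSemidef (K : G → Matrix ι ι ℂ)
    (hK : ∀ ψ : AddChar G ℂ, (∑ d, ψ d • K d).PosSemidef) (u : G → ι → ℂ) :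
    0 ≤ (∑ x, ∑ y, star (u x) ⬝ᵥ ((K (x - y)).mulVec (u y))).re := by
  refine re_blockConvForm_nonneg_of_symbol K (fun ψ v => ?_) u
  have h := (hK ψ).dotProduct_mulVec_nonneg v
  exact (Complex.nonneg_iff.mp h).1


/-- **Real fields, real kernels**: if the complex symbol `Σ_d ψ(d) K(d)` of a real block kernel
satisfies `Re (vᴴ K̂(ψ) v) ≥ 0` for all characters `ψ` and complex `v`, then the real
block-convolution form `Σ_x Σ_y u(x)ᵀ K(x - y) u(y)` is nonnegative on every real field `u` — the
form in which N2's harmonic and nearest-neighbour forms appear after embedding the (finite) support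
into a large discrete torus. [folklore] -/
theorem blockConvForm_nonneg_of_symbol_real (K : G → Matrix ι ι ℝ)
    (hK : ∀ (ψ : AddChar G ℂ) (v : ι → ℂ),
      0 ≤ (star v ⬝ᵥ ((∑ d, ψ d • (K d).map ((↑) : ℝ → ℂ)).mulVec v)).re)
    (u : G → ι → ℝ) :
    0 ≤ ∑ x, ∑ y, u x ⬝ᵥ ((K (x - y)).mulVec (u y)) := by
  have h := re_blockConvForm_nonneg_of_symbol (fun d => (K d).map ((↑) : ℝ → ℂ)) hK
    (fun x i => (u x i : ℂ))
  have hcast : (∑ x, ∑ y, star (fun i => (u x i : ℂ)) ⬝ᵥ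
      (((K (x - y)).map ((↑) : ℝ → ℂ)).mulVec fun i => (u y i : ℂ))) =
      ((∑ x, ∑ y, u x ⬝ᵥ ((K (x - y)).mulVec (u y)) : ℝ) : ℂ) := by
    push_cast
    refine Finset.sum_congr rfl fun x _ => Finset.sum_congr rfl fun y _ => ?_
    simp [dotProduct, Matrix.mulVec, Matrix.map_apply, Complex.ofReal_sum, Complex.ofReal_mul]
  rw [hcast, Complex.ofReal_re] at h
  exact h


/-- **Block Bochner positivity, registered form** (types in `Type`): for a real block kernel `K`
on a finite abelian group `G` whose complex symbol satisfies `Re (vᴴ K̂(ψ) v) ≥ 0` at every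
character, the real block-convolution form is nonnegative on every real field.  This is the step
"LMI / Bloch positivity at every frequency ⇒ positivity of the lattice quadratic form" of N2.
[folklore] -/
theorem blockBochner_nonneg_of_symbol :
    ∀ {G : Type} [AddCommGroup G] [Fintype G] [DecidableEq G] {ι : Type} [Fintype ι] (K : G → Matrix ι ι ℝ), (∀ (ψ : AddChar G ℂ) (v : ι → ℂ), 0 ≤ (star v ⬝ᵥ ((∑ d, ψ d • (K d).map ((↑) : ℝ → ℂ)).mulVec v)).re) → ∀ u : G → ι → ℝ, 0 ≤ ∑ x, ∑ y, u x ⬝ᵥ ((K (x - y)).mulVec (u y)) :=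
  fun K hK u => blockConvForm_nonneg_of_symbol_real K hK u

end Summit.AtomisticToContinuum.Crystallization.Theorems.PricedLinkCensusTruncatedCensusGap

end
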